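import Literature.Geometry.Lorentzian.CauchyDevelopment
import HarnessLib

/-!
# Cauchy developments are globally hyperbolic: compact causal pasts above the data hypersurface
# and closedness of the causal relation (Hawking–Ellis 1973, Prop. 6.6.6 and 6.6.3; O'Neill 1983,
# Lemma 14.22) — named statement

For the spacetime `(M, g, τ)` of a Cauchy development of an initial data set (the data manifold
embedded as a Cauchy hypersurface `ι(X)`, `Literature.Geometry.Lorentzian.CauchyDevelopment`), the
Cauchy development of `ι(X)` is all of `M` (every endless causal curve meets `ι(X)`: O'Neill 1983,
Lemma 14.29, `IsCauchyHypersurface.exists_mem_of_isEndlessCausalCurve_holds`). Hence, by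
S. W. Hawking, G. F. R. Ellis, *The large scale structure of space-time*, CUP 1973, §6.6:
Prop. 6.6.6 (*"If `q ∈ int D(𝒮)`, then `J⁺(𝒮) ∩ J⁻(q)` is compact or empty"*) and its time dual,
and Prop. 6.6.3 (`int D(𝒮)` is globally hyperbolic) with B. O'Neill, *Semi-Riemannian geometry*,
Academic Press 1983, Ch. 14, Lemma 14.22 (*"the relation `≤` is closed on globally hyperbolic
manifolds"*): (i) `J⁻(x) ∩ J⁺(ι X)` is compact for every `x`; (ii) `J⁺(x) ∩ J⁻(ι X)` is compact
for every `x`; (iii) if `xⱼ → x`, `yⱼ → y` and `xⱼ ≤ yⱼ` for all `j`, then `x ≤ y`. These are the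
hypotheses `hK`, `hrel` displayed by the Cauchy-problem files of this directory
(`SpacelikeBoundaryFuturePoint`, `CorrespondingBoundaryShadow`, `CorrespondingBoundaryDomain`) and
of `Summits/FinalStateConjecture` ("not yet theorems over the tree's Cauchy developments"); the
wanted general fact is `isGloballyHyperbolic_iff_exists_isCauchyHypersurface` (docstring of
`Causality.lean`). Recorded here as one named proposition in dimension `3 + 1`, the case used.

* `Literature.Geometry.Lorentzian.hawkingEllis_cauchyDevelopment_causalCompact_closed`

## References

* S. W. Hawking, G. F. R. Ellis, *The large scale structure of space-time*, CUP 1973, §6.5 and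
  §6.6, Prop. 6.6.3, Prop. 6.6.6 (p. 211). [HawkingEllis1973CUP]
* B. O'Neill, *Semi-Riemannian geometry with applications to relativity*, Academic Press 1983,
  Ch. 14, Lemma 14.22 (p. 412), Lemma 14.29 (p. 415). [ONeillSemiRiemannian1983]
-/

namespace Literature.Geometry.Lorentzian

open Function Set Filter Topology TopologicalSpace
open scoped Manifold ContDiff Topology

/-- **Hawking–Ellis 1973, Prop. 6.6.6 with its time dual, and O'Neill 1983, Lemma 14.22 (via
Prop. 6.6.3), for Cauchy developments (dimension `3 + 1`)**: for the spacetime `(M, g, τ)` of a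
Cauchy development of data on a connected smooth `3`-manifold `X` (so that `D(ι X) = M`),
(i) `J⁻(x) ∩ J⁺(ι X)` is compact for every `x ∈ M` (*"If `q ∈ int D(𝒮)`, then `J⁺(𝒮) ∩ J⁻(q)` is
compact or empty"*); (ii) `J⁺(x) ∩ J⁻(ι X)` is compact for every `x` (time dual); (iii) the causal
relation is sequentially closed: `xⱼ → x`, `yⱼ → y`, `xⱼ ≤ yⱼ` for all `j` imply `x ≤ y` (*"`≤` is
closed on globally hyperbolic manifolds"*, `M` being globally hyperbolic by Prop. 6.6.3).
(TODO(general form): any dimension; "int D(𝒮) is globally hyperbolic" for closed achronal `𝒮`,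
and "`≤` closed, `J⁺(p) ∩ J⁻(q)` compact" for globally hyperbolic `M`.)
[cite: HawkingEllis1973CUP, §6.6, Prop. 6.6.6 and Prop. 6.6.3 (p. 211)]
[cite: ONeillSemiRiemannian1983, Ch. 14, Lemma 14.22 (p. 412)]
[file Geometry/Lorentzian/CauchyDevelopmentGlobalHyperbolicity] -/
def hawkingEllis_cauchyDevelopment_causalCompact_closed : Prop :=
  ∀ (X : Type) [TopologicalSpace X] [ChartedSpace (EuclideanSpace ℝ (Fin 3)) X]
    [IsManifold (modelWithCornersSelf ℝ (EuclideanSpace ℝ (Fin 3))) ((⊤ : ℕ∞) : WithTop ℕ∞) X]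
    [ConnectedSpace X]
    (D : Literature.Geometry.Lorentzian.InitialDataSet
      (modelWithCornersSelf ℝ (EuclideanSpace ℝ (Fin 3))) X)
    (𝒟 : Literature.Geometry.Lorentzian.CauchyDevelopment D),
    (∀ x : 𝒟.carrier, IsCompact (𝒟.metric.causalPast 𝒟.timeOrientation {x} ∩
      𝒟.metric.causalFuture 𝒟.timeOrientation (Set.range 𝒟.embed))) ∧
    (∀ x : 𝒟.carrier, IsCompact (𝒟.metric.causalFuture 𝒟.timeOrientation {x} ∩
      𝒟.metric.causalPast 𝒟.timeOrientation (Set.range 𝒟.embed))) ∧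
    (∀ (xs ys : ℕ → 𝒟.carrier) (x y : 𝒟.carrier), Filter.Tendsto xs Filter.atTop (nhds x) →
      Filter.Tendsto ys Filter.atTop (nhds y) →
      (∀ j, ys j ∈ 𝒟.metric.causalFuture 𝒟.timeOrientation {xs j}) →
      y ∈ 𝒟.metric.causalFuture 𝒟.timeOrientation {x})

end Literature.Geometry.Lorentzian
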